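import Summits.Langlands.Langlands.Theorems.SoloInformedCrystallineCompatibleHeckeTrivial
import Literature.NumberTheory.GaloisRepresentations.CharacterFromFrobeniusPair
import Literature.NumberTheory.Automorphic.GKModulesAdmissible
import Literature.RingTheory.DedekindDomain.UnitsAtCofinitelyManyPrimes
import HarnessLib

/-!
# Rank-one rigidity of the summit's unramified clause, and what it pins on genuine `GL_1` terms
# (rung Λ16)

Programme `solo-Langlands-informed` (statement analysis of `Summit.Langlands`; repair D2-cris).  Rung Λ15
(`SoloInformedCrystallineCompatibleHeckeTrivial`) evaluated the summit's unramified clause (C)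
`SatakeFrobCompatibleAt ι π ρ v` and the repaired `v ∣ ℓ` clause `D2Cris.CrystallineCompatibleAt` on the genuine
`GL_1` pairs `(π_𝟙, 𝟙)` and `(π_{‖·‖^k}, χ_ℓ^k)`.  This file proves that on `GL_1` the unramified clause ALONE,
at all but finitely many places, already determines the Galois side ON THE NOSE, and draws the consequences for
the summit's direction (A) `AutomorphicToGalois 1 𝓡 hcpt` and for the repair:

* §1 ★★ `eq_of_eventually_satakeFrobCompatibleAt`: for ANY automorphic representation `π` of `GL_1(𝔸_K)`
  (Borel–Jacquet datum) and any two `ρ ρ' : Γ_K →ₜ* GL_1(ℚ̄_ℓ)` with `∀ᶠ v, SatakeFrobCompatibleAt ι π ρ v` and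
  the same for `ρ'`, `ρ = ρ'` — Flath's uniqueness of Satake parameters
  (`AutomorphicRepData.hasSatakeParamAt_unique_holds`), Frobenius density (Chebotarev, tree theorem
  `Automorphic.chebotarev_artinRep_holds`, through `FramedGaloisRep.eq_or_eq_of_frobenius`) and "a `1 × 1` matrix is
  its characteristic polynomial" (`FramedRep.apply_eq_of_charpoly_eq`).  Hence ★★ `isConjugate_of_corresponds_glOne`:
  the UNIQUENESS conjunct of (A) holds in rank one for every reciprocity datum `𝓡`, every `π` and every `ι`, from
  the `𝓡`-free conjunct of `Corresponds` alone; and ★★ `automorphicToGalois_one_iff`: (A) for `GL_1` is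
  equivalent to bare EXISTENCE of a geometric corresponding `ρ` (irreducibility is automatic in rank one,
  `isIrreducible_of_finrank_eq_one'`; uniqueness is §1).  (In rank `n` the tree has the up-to-conjugacy version
  for an irreducible partner, `ReciprocityUpToIrreducibility.isConjugate_of_satakeFrobCompatibleAt`; rank one needs
  neither irreducibility nor Brauer–Nesbitt and gives equality of framed representations.)
* §2 on the genuine terms of Λ15: ★★ `eventually_satakeFrobCompatibleAt_trivial_iff` /
  `eventually_satakeFrobCompatibleAt_normPow_iff`: for `π_𝟙 = ℂ·𝟙/⊥` (resp. `π_{‖·‖^k} = ℂ·‖det‖^k/⊥`) and ANY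
  `ρ' : Γ_K →ₜ* GL_1(ℚ̄_ℓ)`, `(∀ᶠ v, SatakeFrobCompatibleAt ι π ρ' v) ↔ ρ' = 𝟙` (resp. `↔ ρ' = χ_ℓ^k`,
  `FramedRep.twist 𝟙 (D2Cris.tateChar K ℓ k)`).  Consequently ★★★
  `crystallineCompatibleAt_of_eventually_satakeFrobCompatibleAt_normPow` (and `_trivial`): on these `π` the
  summit's `𝓡`-free clause a.e. IMPLIES the repaired clause `CrystallineCompatibleAt ι π ρ' v hv` at EVERY `v ∣ ℓ`
  for every candidate `ρ'` — the repair D2-cris adds no constraint on the Tate family beyond what clause (C) already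
  forces (as a correct `v ∣ ℓ` clause must, the Galois partner being determined by (C)); and ★★
  `exists_corresponds_normPow_iff`: for every `𝓡`, the (A)-existence statement at `π_{‖·‖^k}` is decided by the
  single representation `χ_ℓ^k`: `(∃ ρ, IsGeometricFramed 𝓡 ρ ∧ Corresponds 𝓡 ι π ρ) ↔
  IsGeometricFramed 𝓡 χ_ℓ^k ∧ Corresponds 𝓡 ι π χ_ℓ^k` — i.e. on the Tate family the summit's (A) is a statement
  about `χ_ℓ^k` and the pinned data `𝓡.pst`, `𝓡.llc` only.

No new definitions; no hypotheses beyond the data.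

References: Serre, *Abelian ℓ-adic representations and elliptic curves* (1968), Ch. I §2.2 Cor. 2 (a), §2.3;
Deligne–Serre, Ann. Sci. ÉNS 7 (1974), Lemme 3.2; Buzzard–Gee, LMS LNS 414 (2014), Conj. 3.2.1, 3.2.2, Rem. 3.2.5;
Borel–Jacquet, Proc. Sympos. Pure Math. 33 (1979), part 1, 4.6; Fontaine–Mazur (1995), §1.
-/

noncomputable section

open scoped MatrixGroups Matrix Classical Polynomial NumberField
open NumberField IsDedekindDomain Field Polynomial Filter
open Literature.NumberTheory.Automorphic Literature.NumberTheory.GaloisRepresentations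

namespace Summit.Langlands.Langlands.Theorems

namespace GLOneRigidity

/-! ### §1 Rank-one rigidity of the unramified clause -/

section Rigidity

variable {K : Type} [Field K] [NumberField K] {hcpt : isCompact_glFiniteIntegralLevel 1 K}

/-- ★★ **In rank one the summit's unramified clause, at all but finitely many places, determines the Galois side on
the nose.**  If `ρ, ρ' : Γ_K →ₜ* GL_1(ℚ̄_ℓ)` both satisfy `SatakeFrobCompatibleAt ι π · v` for all but finitely many
`v`, for one automorphic representation `π` of `GL_1(𝔸_K)`, then `ρ = ρ'`: at a common good place the two Satake
parameters coincide (Flath, `hasSatakeParamAt_unique_holds`), so every arithmetic Frobenius there has the same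
characteristic polynomial under `ρ` and `ρ'`, hence the same value (`1 × 1` matrices,
`FramedRep.apply_eq_of_charpoly_eq`); such Frobenii are dense (Chebotarev, `FramedGaloisRep.eq_or_eq_of_frobenius`).
[cite: SerreAbelianLadic1968, Ch. I §2.2 Cor. 2 (a), §2.3] [cite: BuzzardGeeLMS2014, Conj. 3.2.1 and Rem. 3.2.5] -/
theorem eq_of_eventually_satakeFrobCompatibleAt {ℓ : ℕ} [Fact ℓ.Prime] (ι : PadicAlgCl ℓ ≃+* ℂ)
    (π : AutomorphicRepData (AutomorphyDatum.gl 1 K hcpt)) {ρ ρ' : FramedGaloisRep K (PadicAlgCl ℓ) 1}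
    (hρ : ∀ᶠ v : HeightOneSpectrum (𝓞 K) in cofinite, SatakeFrobCompatibleAt ι π ρ v)
    (hρ' : ∀ᶠ v : HeightOneSpectrum (𝓞 K) in cofinite, SatakeFrobCompatibleAt ι π ρ' v) : ρ = ρ' := by
  have hS := Filter.eventually_cofinite.1 (hρ.and hρ')
  refine (FramedGaloisRep.eq_or_eq_of_frobenius ρ ρ' ρ' hS fun v hv 𝔓 h𝔓 σ hσ => Or.inl ?_).elim id id
  simp only [Set.mem_setOf_eq, not_not] at hv
  obtain ⟨⟨α, hα, -, hP⟩, ⟨β, hβ, -, hP'⟩⟩ := hv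
  obtain rfl : α = β := AutomorphicRepData.hasSatakeParamAt_unique_holds π hα hβ
  exact FramedRep.apply_eq_of_charpoly_eq ((hP 𝔓 h𝔓 σ hσ).trans (hP' 𝔓 h𝔓 σ hσ).symm)

/-- ★★ **The uniqueness conjunct of (A) in rank one, for every reciprocity datum.**  Two representations
`ρ, ρ' : Γ_K →ₜ* GL_1(ℚ̄_ℓ)` which both `Correspond` (via `ι`, for ANY `𝓡`) to one automorphic representation `π`
of `GL_1(𝔸_K)` are conjugate — indeed equal (`eq_of_eventually_satakeFrobCompatibleAt`); only the `𝓡`-free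
conjunct `∀ᶠ v, SatakeFrobCompatibleAt ι π · v` of `Corresponds` is used.
[cite: BuzzardGeeLMS2014, Conj. 3.2.1 and Conj. 3.2.2] [cite: SerreAbelianLadic1968, Ch. I §2.2 Cor. 2 (a), §2.3] -/
theorem isConjugate_of_corresponds_glOne {ℓ : ℕ} [Fact ℓ.Prime] (𝓡 : ReciprocityData K)
    (ι : PadicAlgCl ℓ ≃+* ℂ) (π : AutomorphicRepData (AutomorphyDatum.gl 1 K hcpt))
    {ρ ρ' : FramedGaloisRep K (PadicAlgCl ℓ) 1} (hρ : Corresponds 𝓡 ι π ρ) (hρ' : Corresponds 𝓡 ι π ρ') :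
    IsConjugate ρ ρ' := by
  obtain rfl := eq_of_eventually_satakeFrobCompatibleAt ι π hρ.1 hρ'.1
  exact IsConjugate.refl _

/-- ★★ **Direction (A) for `GL_1` is equivalent to bare existence.**  `AutomorphicToGalois 1 𝓡 hcpt` holds iff every
L-algebraic cuspidal `π` of `GL_1(𝔸_K)` has, for every `ℓ` and `ι`, SOME geometric `ρ : Γ_K →ₜ* GL_1(ℚ̄_ℓ)` with
`Corresponds 𝓡 ι π ρ`: irreducibility is automatic in rank one (`isIrreducible_of_finrank_eq_one'`) and uniqueness
up to conjugacy is `isConjugate_of_corresponds_glOne`.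
[cite: BuzzardGeeLMS2014, Conj. 3.2.1 and Conj. 3.2.2] [cite: FontaineMazurGeometric1995, §1] -/
theorem automorphicToGalois_one_iff (𝓡 : ReciprocityData K) :
    AutomorphicToGalois 1 𝓡 hcpt ↔
      ∀ π : CuspidalAutomorphicRepData 1 K hcpt, π.1.IsLAlgebraic →
        ∀ (ℓ : ℕ) [Fact ℓ.Prime] (ι : PadicAlgCl ℓ ≃+* ℂ),
          ∃ ρ : FramedGaloisRep K (PadicAlgCl ℓ) 1, IsGeometricFramed 𝓡 ρ ∧ Corresponds 𝓡 ι π.1 ρ := by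
  refine ⟨fun h π hπ ℓ _ ι => ?_, fun h π hπ ℓ _ ι => ?_⟩
  · obtain ⟨ρ, -, hg, hc, -⟩ := h π hπ ℓ ι
    exact ⟨ρ, hg, hc⟩
  · obtain ⟨ρ, hg, hc⟩ := h π hπ ℓ ι
    exact ⟨ρ, isIrreducible_of_finrank_eq_one' _ (Module.finrank_fin_fun _), hg, hc,
      fun ρ' hρ' => isConjugate_of_corresponds_glOne 𝓡 ι π.1 hc hρ'⟩

end Rigidity

/-! ### §2 The genuine terms: `π_𝟙` pins `𝟙`, `π_{‖·‖^k}` pins `χ_ℓ^k` -/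

section Genuine

variable {K : Type} [Field K] [NumberField K] {hcpt : isCompact_glFiniteIntegralLevel 1 K}
  {ℓ : ℕ} [Fact ℓ.Prime]

/-- All but finitely many finite places of `K` are prime to `ℓ` (tree
`Literature.RingTheory.DedekindDomain.eventually_not_mem_asIdeal`). [folklore] -/
private theorem eventually_natCast_not_mem_asIdeal :
    ∀ᶠ v : HeightOneSpectrum (𝓞 K) in cofinite, ((ℓ : ℕ) : 𝓞 K) ∉ v.asIdeal :=
  Literature.RingTheory.DedekindDomain.eventually_not_mem_asIdeal
    (Nat.cast_ne_zero.mpr (Fact.out : ℓ.Prime).ne_zero)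

/-- ★★ **`π_𝟙` pins the trivial representation.**  For the automorphic representation `π_𝟙 = ℂ·𝟙/⊥` of
`GL_1(𝔸_K)` and ANY `ρ' : Γ_K →ₜ* GL_1(ℚ̄_ℓ)`: the summit's unramified clause holds at all but finitely many places
iff `ρ' = 𝟙` (Λ15 `satakeFrobCompatibleAt_trivial_glOne` and §1).
[cite: BuzzardGeeLMS2014, Conj. 3.2.1 and Rem. 3.2.5] [cite: BorelJacquet1979, 4.6] -/
theorem eventually_satakeFrobCompatibleAt_trivial_iff (ι : PadicAlgCl ℓ ≃+* ℂ)
    {π : AutomorphicRepData (AutomorphyDatum.gl 1 K hcpt)}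
    (hW : π.W = Submodule.span ℂ
      {fun g : (AdelicGroupData.gl 1 K).Adelic => (detTwist 1 (1 : HeckeCharacter K) g : ℂ)})
    (hW' : π.W' = ⊥) (ρ' : FramedGaloisRep K (PadicAlgCl ℓ) 1) :
    (∀ᶠ v : HeightOneSpectrum (𝓞 K) in cofinite, SatakeFrobCompatibleAt ι π ρ' v) ↔
      ρ' = (1 : FramedGaloisRep K (PadicAlgCl ℓ) 1) := by
  have h1 : ∀ᶠ v : HeightOneSpectrum (𝓞 K) in cofinite,
      SatakeFrobCompatibleAt ι π (1 : FramedGaloisRep K (PadicAlgCl ℓ) 1) v :=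
    Eventually.of_forall fun v => D2Cris.satakeFrobCompatibleAt_trivial_glOne hcpt ι hW hW' v
  refine ⟨fun h => (eq_of_eventually_satakeFrobCompatibleAt ι π h1 h).symm, fun h => ?_⟩
  subst h
  exact h1

/-- ★★ **`π_{‖·‖^k}` pins `χ_ℓ^k`.**  For the automorphic representation `π_{‖·‖^k} = ℂ·‖det‖^k/⊥` of `GL_1(𝔸_K)`
and ANY `ρ' : Γ_K →ₜ* GL_1(ℚ̄_ℓ)`: the summit's unramified clause holds at all but finitely many places iff
`ρ' = χ_ℓ^k = 𝟙 ⊗ tateChar K ℓ k` (Λ15 `satakeFrobCompatibleAt_normPow_tateChar` at `v ∤ ℓ`, and §1).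
[cite: BuzzardGeeLMS2014, Conj. 3.2.1 and Rem. 3.2.5] [cite: SerreAbelianLadic1968, Ch. I §1.2 (Example: the cyclotomic character)] -/
theorem eventually_satakeFrobCompatibleAt_normPow_iff (ι : PadicAlgCl ℓ ≃+* ℂ) (k : ℕ)
    {π : AutomorphicRepData (AutomorphyDatum.gl 1 K hcpt)}
    (hW : π.W = Submodule.span ℂ
      {fun g : (AdelicGroupData.gl 1 K).Adelic => (detTwist 1 (HeckeCharacter.normCharacter K ^ k) g : ℂ)})
    (hW' : π.W' = ⊥) (ρ' : FramedGaloisRep K (PadicAlgCl ℓ) 1) :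
    (∀ᶠ v : HeightOneSpectrum (𝓞 K) in cofinite, SatakeFrobCompatibleAt ι π ρ' v) ↔
      ρ' = FramedRep.twist (1 : FramedGaloisRep K (PadicAlgCl ℓ) 1) (D2Cris.tateChar K ℓ k) := by
  have hχ : ∀ᶠ v : HeightOneSpectrum (𝓞 K) in cofinite,
      SatakeFrobCompatibleAt ι π (FramedRep.twist (1 : FramedGaloisRep K (PadicAlgCl ℓ) 1) (D2Cris.tateChar K ℓ k)) v :=
    eventually_natCast_not_mem_asIdeal.mono fun v hv =>
      D2Cris.satakeFrobCompatibleAt_normPow_tateChar hcpt ι k hW hW' hv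
  refine ⟨fun h => (eq_of_eventually_satakeFrobCompatibleAt ι π hχ h).symm, fun h => ?_⟩
  subst h
  exact hχ

/-- ★★★ **On `π_𝟙` the summit's unramified clause a.e. already implies the repaired `v ∣ ℓ` clause D2-cris at every
`v ∣ ℓ`, for every candidate `ρ'`** (`ρ'` is forced to be `𝟙`, and Λ15 `crystallineCompatibleAt_trivial_glOne`).
[cite: BuzzardGeeLMS2014, Conj. 3.2.2] [cite: Colmez1998Annals, Lemme III.3.4] -/
theorem crystallineCompatibleAt_of_eventually_satakeFrobCompatibleAt_trivial (ι : PadicAlgCl ℓ ≃+* ℂ)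
    {π : AutomorphicRepData (AutomorphyDatum.gl 1 K hcpt)}
    (hW : π.W = Submodule.span ℂ
      {fun g : (AdelicGroupData.gl 1 K).Adelic => (detTwist 1 (1 : HeckeCharacter K) g : ℂ)})
    (hW' : π.W' = ⊥) {ρ' : FramedGaloisRep K (PadicAlgCl ℓ) 1}
    (h : ∀ᶠ v : HeightOneSpectrum (𝓞 K) in cofinite, SatakeFrobCompatibleAt ι π ρ' v)
    (v : HeightOneSpectrum (𝓞 K)) (hv : ((ℓ : ℕ) : 𝓞 K) ∈ v.asIdeal) :
    D2Cris.CrystallineCompatibleAt ι π ρ' v hv := by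
  obtain rfl := (eventually_satakeFrobCompatibleAt_trivial_iff ι hW hW' ρ').1 h
  exact D2Cris.crystallineCompatibleAt_trivial_glOne hcpt ι hW hW' v hv

/-- ★★★ **On `π_{‖·‖^k}` the summit's unramified clause a.e. already implies the repaired `v ∣ ℓ` clause D2-cris at
every `v ∣ ℓ`, for every candidate `ρ'`** (`ρ'` is forced to be `χ_ℓ^k`, and Λ15
`crystallineCompatibleAt_normPow_tateChar`): on the Tate family the repair adds no constraint beyond clause (C).
[cite: BuzzardGeeLMS2014, Conj. 3.2.2] [cite: Colmez1998Annals, Lemme III.3.4] -/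
theorem crystallineCompatibleAt_of_eventually_satakeFrobCompatibleAt_normPow (ι : PadicAlgCl ℓ ≃+* ℂ) (k : ℕ)
    {π : AutomorphicRepData (AutomorphyDatum.gl 1 K hcpt)}
    (hW : π.W = Submodule.span ℂ
      {fun g : (AdelicGroupData.gl 1 K).Adelic => (detTwist 1 (HeckeCharacter.normCharacter K ^ k) g : ℂ)})
    (hW' : π.W' = ⊥) {ρ' : FramedGaloisRep K (PadicAlgCl ℓ) 1}
    (h : ∀ᶠ v : HeightOneSpectrum (𝓞 K) in cofinite, SatakeFrobCompatibleAt ι π ρ' v)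
    (v : HeightOneSpectrum (𝓞 K)) (hv : ((ℓ : ℕ) : 𝓞 K) ∈ v.asIdeal) :
    D2Cris.CrystallineCompatibleAt ι π ρ' v hv := by
  obtain rfl := (eventually_satakeFrobCompatibleAt_normPow_iff ι k hW hW' ρ').1 h
  exact D2Cris.crystallineCompatibleAt_normPow_tateChar hcpt ι k hW hW' v hv

/-- ★★ **Whatever the reciprocity datum, the only possible Galois partner of `π_{‖·‖^k}` is `χ_ℓ^k`.**
`Corresponds 𝓡 ι π_{‖·‖^k} ρ'` forces `ρ' = 𝟙 ⊗ tateChar K ℓ k`, for every `𝓡`.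
[cite: BuzzardGeeLMS2014, Conj. 3.2.1 and Conj. 3.2.2] [cite: SerreAbelianLadic1968, Ch. I §1.2 (Example: the cyclotomic character)] -/
theorem eq_twist_tateChar_of_corresponds_normPow (𝓡 : ReciprocityData K) (ι : PadicAlgCl ℓ ≃+* ℂ) (k : ℕ)
    {π : AutomorphicRepData (AutomorphyDatum.gl 1 K hcpt)}
    (hW : π.W = Submodule.span ℂ
      {fun g : (AdelicGroupData.gl 1 K).Adelic => (detTwist 1 (HeckeCharacter.normCharacter K ^ k) g : ℂ)})
    (hW' : π.W' = ⊥) {ρ' : FramedGaloisRep K (PadicAlgCl ℓ) 1} (h : Corresponds 𝓡 ι π ρ') :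
    ρ' = FramedRep.twist (1 : FramedGaloisRep K (PadicAlgCl ℓ) 1) (D2Cris.tateChar K ℓ k) :=
  (eventually_satakeFrobCompatibleAt_normPow_iff ι k hW hW' ρ').1 h.1

/-- ★★ **On the Tate family the (A)-existence statement is decided by one representation.**  For every `𝓡`, `ι`,
`k`: `π_{‖·‖^k}` has SOME geometric corresponding `ρ` iff `χ_ℓ^k` itself is geometric (for the pinned `𝓡.pst`)
and corresponds (for `𝓡.llc`) — the summit's (A) at `π_{‖·‖^k}` is a statement about `χ_ℓ^k` and the pinned data.
[cite: BuzzardGeeLMS2014, Conj. 3.2.1 and Conj. 3.2.2] [cite: FontaineMazurGeometric1995, §1] -/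
theorem exists_corresponds_normPow_iff (𝓡 : ReciprocityData K) (ι : PadicAlgCl ℓ ≃+* ℂ) (k : ℕ)
    {π : AutomorphicRepData (AutomorphyDatum.gl 1 K hcpt)}
    (hW : π.W = Submodule.span ℂ
      {fun g : (AdelicGroupData.gl 1 K).Adelic => (detTwist 1 (HeckeCharacter.normCharacter K ^ k) g : ℂ)})
    (hW' : π.W' = ⊥) :
    (∃ ρ : FramedGaloisRep K (PadicAlgCl ℓ) 1, IsGeometricFramed 𝓡 ρ ∧ Corresponds 𝓡 ι π ρ) ↔
      IsGeometricFramed 𝓡 (FramedRep.twist (1 : FramedGaloisRep K (PadicAlgCl ℓ) 1) (D2Cris.tateChar K ℓ k)) ∧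
        Corresponds 𝓡 ι π (FramedRep.twist (1 : FramedGaloisRep K (PadicAlgCl ℓ) 1) (D2Cris.tateChar K ℓ k)) := by
  refine ⟨fun ⟨ρ, hg, hc⟩ => ?_, fun h => ⟨_, h⟩⟩
  obtain rfl := eq_twist_tateChar_of_corresponds_normPow 𝓡 ι k hW hW' hc
  exact ⟨hg, hc⟩

/-- ★ **The `𝓡`-free half of geometricity for `χ_ℓ^k`**: `𝟙 ⊗ tateChar K ℓ k` is unramified at all but finitely
many places (Λ15 `isUnramifiedAt_twist_one_tateChar` at every `v ∤ ℓ`); the remaining conjunct of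
`IsGeometricFramed 𝓡 χ_ℓ^k` is de Rham-ness at `v ∣ ℓ` for the PINNED period datum `𝓡.pst ℓ v hv`.
[cite: SerreAbelianLadic1968, Ch. I §1.2 (Example: the cyclotomic character)] [cite: FontaineMazurGeometric1995, §1] -/
theorem eventually_isUnramifiedAt_twist_one_tateChar (k : ℕ) :
    ∀ᶠ v : HeightOneSpectrum (𝓞 K) in cofinite,
      FramedGaloisRep.IsUnramifiedAt v (FramedRep.twist (1 : FramedGaloisRep K (PadicAlgCl ℓ) 1) (D2Cris.tateChar K ℓ k)) :=
  eventually_natCast_not_mem_asIdeal.mono fun _ hv => D2Cris.isUnramifiedAt_twist_one_tateChar k hv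

end Genuine

end GLOneRigidity

end Summit.Langlands.Langlands.Theorems

end
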